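/-
Origin: expansion seat `planner-pub-hodgecm-pv12-g9-0`, handover #3 md5 e93c467ad5bcf6fe5274a8556ab9f5b7 (77 l., 2 decls); NEW additive leaf; imports row #2 => ONE rewrite `^import Pv12g9\.FockPrintTorusOrbit` -> `import HodgeCM.PerL34.FockPrintTorusOrbit`; + tree HodgeCM.PerL34.PrintedSmoothEndState (stays); install AFTER rows #1,#2; HOLD iff #2 held; frozen wip/FockPrintTorusOrbitSide.lean.e93c467ad5bcf6fe5274a8556ab9f5b7.bak; LANDABLE 15:10Z (check-wip rc=0  (`HOME/pub-hodgecm-pv12-g9/lean/Pv12g9/FockPrintTorusOrbitSide.lean`, md5 e93c467a, 77 lines);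
landed by the gen-8 packager in gate run 31 as `HodgeCM/PerL34/FockPrintTorusOrbitSide.lean` (import ^import Pv12g9\.FockPrintTorusOrbit[ \t]*$→import HodgeCM.PerL34.FockPrintTorusOrbit ×1).
-/
import Summits.HodgeConjecture.HodgeCM.PerL34.FockPrintTorusOrbit_2
import Summits.HodgeConjecture.HodgeCM.PerL34.PrintedSmoothEndState_2

/-!
# The torus part of `smooth` / `hF` on pv11-g9's frozen S4 interface (KERNEL corollary; pv12-g9, RUN 31 row #3)

Additive leaf over `FockPrintTorusOrbit` (row #2) and the tree interface `ArchC.LinSmoothSide`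
(`PrintedSmoothEndState.lean`).  For the 𝒯-free linear side `A : LinSmoothSide C P RP kind λ hλ (pinnedVacs kind m₁ m₂) ιT`
of ANY isolation core `C` — i.e. exactly the datum the end-state cores `LinSmoothCore12/34` carry — and every torus
velocity `(α, δ) : (RP → ℝ) × (RP → ℝ)`:

* `LinSmoothSide.hasDerivAt_pointFunctional_torus` — the `hF` clause of node #5 (`LinOrbitSide.hF`, the shape
  `HasDerivAt (s ↦ 𝒯_{ω(e s)(φ⊗Φ_f)}(·)(g)) (𝒯_{(Xφ)⊗Φ_f}(·)(g)) 0`) for `e := ιT ∘ torusCurve α δ`, `X := torusGen α δ`, from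
  the field `A.omg_ins` and the two linearity laws `TΦc_add / TΦc_smul` of `Φ ↦ 𝒯_Φ` ([SETUP D4]; the same two laws
  `LinSmoothSide.toLinOrbit` takes) — over the BARE `[TopologicalSpace SK]` of the interface, no compatibility needed;
* `LinSmoothSide.tendsto_slope_torus` — the `smooth` clause itself (`LinSmoothSide.smooth`'s shape) for the same `e, X`,
  from `A.omg_ins` alone, under the two instances `[IsTopologicalAddGroup SK] [ContinuousSMul ℂ SK]` making `SK`'s topology a
  vector-space topology (for `SK = 𝒮^κ ⊂ S(X_A)`: [We64] n° 11; a property of the constructed model, see row #2's header).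

Reading (GAPS.md pv12g9-1, pv12g9-2; joint with pv06-g7 `ArchCHyperbolic`): were a torus index kept in `A.ιR` with
`A.e j = ιT ∘ torusCurve α δ` and `A.XR j = torusGen α δ`, its `smooth` / `hF` instance is a theorem of the package, not a use of
the D5′ / O14-R print warrant; that warrant is load-bearing only for the non-torus (hyperbolic) directions.
No published result is cited as a hypothesis; PerL / QW8 / 2001-programme claims are not cited.
-/

noncomputable section

open Filter Topology
open HodgeCM.Prior.Perl34File HodgeCM.Prior.Perl34File.Perl34
open HodgeCM.PerL34.Fock HodgeCM.PerL34.Fock.PrintDict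

namespace HodgeCM
namespace PerL34
namespace ArchC
namespace LinSmoothSide

variable {H HG CG G SK SigIdx SigIdxG : Type*}
variable [NormedAddCommGroup H] [InnerProductSpace ℂ H] [CompleteSpace H]
variable [NormedAddCommGroup HG] [InnerProductSpace ℂ HG] [CompleteSpace HG]
variable [NormedAddCommGroup CG] [NormedSpace ℂ CG]
variable [Group G] [TopologicalSpace G] [TopologicalSpace SK] [AddCommGroup SK] [Module ℂ SK]
variable {C : IsolationCore H HG CG G SK SigIdx SigIdxG} {P : C4a.PointedCore C}
variable {RP : Type} [Fintype RP] [DecidableEq RP] {kind : RP → PlaceKind} {lam : RP → ℂ} {hlam : ∀ b, lam b ≠ 0}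
variable {m₁ m₂ : RP → ℤ} {ιT : (pinnedPlaces RP kind lam hlam m₁ m₂).Tg →* G}

/-- **Torus part of `hF` (KERNEL)**: for the 𝒯-free linear side of any isolation core at the pinned printed places, the
node-#5 derivative clause along every torus direction `(α, δ)` with the explicit printed generator `torusGen α δ`, from
`omg_ins` and the linearity of `Φ ↦ 𝒯_Φ` — no topology compatibility on `SK`. -/
theorem hasDerivAt_pointFunctional_torus (A : LinSmoothSide C P RP kind lam hlam (pinnedVacs kind m₁ m₂) ιT)
    (TΦc_add : ∀ Φ Ψ : SK, C.TΦc (Φ + Ψ) = C.TΦc Φ + C.TΦc Ψ)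
    (TΦc_smul : ∀ (c : ℂ) (Φ : SK), C.TΦc (c • Φ) = c • C.TΦc Φ)
    (α δ : RP → ℝ) (f : A.FinIdx) (φ : (pinnedPlaces RP kind lam hlam m₁ m₂).F) (p : P.Pt) :
    HasDerivAt (fun s : ℝ => C4a.pointFunctional C P
        (C.omg (ιT (torusCurve RP kind lam hlam m₁ m₂ α δ s)) (A.ins f φ)) p)
      (C4a.pointFunctional C P (A.ins f (torusGen RP kind lam hlam m₁ m₂ α δ φ)) p) 0 :=
  hasDerivAt_apply_omg_torus RP kind lam hlam m₁ m₂ α δ C.omg ιT (A.ins f) (A.omg_ins f)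
    (fun s => ιT (torusCurve RP kind lam hlam m₁ m₂ α δ s)) (fun _ => rfl)
    (pointFunctionalₗ TΦc_add TΦc_smul p) φ

/-- **Torus part of `smooth` (KERNEL)**: the `LinSmoothSide.smooth`-shaped clause along every torus direction, from
`omg_ins` alone, once `SK`'s topology is a vector-space topology. -/
theorem tendsto_slope_torus [IsTopologicalAddGroup SK] [ContinuousSMul ℂ SK]
    (A : LinSmoothSide C P RP kind lam hlam (pinnedVacs kind m₁ m₂) ιT)
    (α δ : RP → ℝ) (f : A.FinIdx) (φ : (pinnedPlaces RP kind lam hlam m₁ m₂).F) :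
    Tendsto (fun s : ℝ => ((s : ℝ) : ℂ)⁻¹ •
        (C.omg (ιT (torusCurve RP kind lam hlam m₁ m₂ α δ s)) (A.ins f φ) -
          C.omg (ιT (torusCurve RP kind lam hlam m₁ m₂ α δ 0)) (A.ins f φ)))
      (𝓝[≠] 0) (𝓝 (A.ins f (torusGen RP kind lam hlam m₁ m₂ α δ φ))) :=
  tendsto_slope_omg_torus RP kind lam hlam m₁ m₂ α δ C.omg ιT (A.ins f) (A.omg_ins f)
    (fun s => ιT (torusCurve RP kind lam hlam m₁ m₂ α δ s)) (fun _ => rfl) φ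

end LinSmoothSide
end ArchC
end PerL34
end HodgeCM

end
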